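import Summits.BirchSwinnertonDyer.BirchSwinnertonDyer.Theorems.PrintCf2SplitBadTwoLayerNormUnitTwist
import Literature.NumberTheory.EllipticCurves.Kato2004.IwasawaLayerQuadraticTwistH1Proofs
import Literature.NumberTheory.EllipticCurves.Kato2004.IwasawaUnitTwistH1Proofs
import Literature.NumberTheory.EllipticCurves.CuspFormLFunction
import Literature.NumberTheory.EllipticCurves.TateModuleContinuityProofs
import Literature.NumberTheory.EllipticCurves.GlobalMinimalModelProofs
import Literature.NumberTheory.EllipticCurves.QuadraticTwistJInvariantProofs
import Literature.NumberTheory.EllipticCurves.IrreducibleModPQuadraticTwistProofs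
import Literature.NumberTheory.EllipticCurves.LFunctionSmulProofs
import Literature.NumberTheory.EllipticCurves.BSDSelmerSkinnerThmBProofs
import HarnessLib

/-!
# Route ByReductionTypeAtTwo, crux C4″ `AdditivePotMultOverKAtTwo` (stmt-BirchSwinnertonDyer-22618; parent 19098) — reading
# R15 (iii), the GALOIS identification, `I`-HALF IN THE KERNEL: the layer isomorphisms
# `ψ_n : H¹(ℚ_{n+1}, T₂W₂) ≃+ H¹(ℚ_{n+1}, T₂W)` and the `Tw`-semilinear identification `𝐇¹_Γ(T₂W₂) ≅ 𝐇¹_Γ(T₂W)` for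
# a model `W₂` of `W^{(2)}`; and the `(−1)`-block AVATAR `W₂` of a `(−2)`-block curve `W`

Cell `bsd-2adic` (run/shared/lean/pub/bsd-2adic/), seat `bsd-2adic-k4-w3` GEN 3 (explicit unit of director-bsd g16 (309)(7):
«C4″ 22618 narrowed»; pen RC-384 lane «k4-w3 successor = the I-half layer isos … + cores to layer 0 into `IwasawaH1Data`»).
GEN 0 priced R15 («the (−2)-split-twist blocks of C4″ are the (−1)-blocks at `W^{(2)}`; `T₂W ≅ T₂W₂ ⊗ χ₂`») as a READING;
GEN 2 (`…AdditiveGammaTwistTransport`, `…AdditiveGammaTwistPackageTransport`) put its analytic and algebraic sides in the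
kernel and reduced the Galois side (iii) to GROUP-LEVEL data: (a) layer isomorphisms `ψ_n` (`n ≥ 0`; `ℤ₂`-linear,
trace-compatible, ANTI-commuting with `conj_γ`) and (b) a Selmer isomorphism `φ` over `ℚ_∞` anti-commuting with
`conj_{γ⁻¹}`. THIS FILE supplies (a) — hence the `IwasawaH1Data`-half of the `Tw`-identification of the Kato carriers —
and the avatar bookkeeping, all as THEOREMS:

* §1 `exists_iwasawaH1Data_negTwist_two` — for `W, W₂` elliptic over `ℚ` with `C • W₂ = W^{(2)}` (ANY model of the twist
  by `2`), `κ` cyclotomic and `γ` a topological generator: every pin `I : IwasawaH1Data W 2 κ γ` has a twin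
  `I₂ : IwasawaH1Data W₂ 2 κ γ` with `eI : I₂.H ≃+ I.H`, `eI (r • h) = Tw(r) • eI h` (`Tw = unitTwist · (−1)`) — the
  `I`-component of the hypothesis `hTw` of `katoOddBranchInputsNegTwoPrintExact_of_negOne_of_twTransport`. It is the
  composite of the Literature construction `Kato2004.exists_layerIsos_of_smul_eq_quadraticTwist_two_of_isTopGenerator`
  (GEN 3: `ψ_n = E_*` for the sign-twisted equivariant `E : T₂W₂ ≃ T₂W` of
  `WeierstrassCurve.exists_tateModule_equiv_of_smul_eq_quadraticTwist`, `√2 ∈ ℚ₁`, `γ√2 = −√2`) with GEN 2's adapter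
  `Kato2004.iwasawaH1Data_exists_negTwist`; `exists_layerIsos_two` re-exports the `ψ_n` in the exact shape of the
  `∃ ψ` clause of `katoOddBranchInputsNegTwoPrintExact_of_negOne_of_layerIsos`.
* §2 `exists_negOneAvatar_of_quadraticTwist_two` — every elliptic `W/ℚ` has a GLOBALLY MINIMAL model `W₂` of `W^{(2)}`
  (`C • W₂ = W^{(2)}`), and for it: `W₂^{(−1)}` split multiplicative at `2` ⟺ `W^{(−2)}` split multiplicative at `2`
  (`W₂^{(−1)} ≅_ℚ W^{(−2)}`: `quadraticTwist_smul`, `quadraticTwist_quadraticTwist`, `hasSplitMultiplicativeReductionAtPrime_smul_iff`),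
  `W₂[2]` irreducible ⟺ `W[2]` irreducible (`hasIrreducibleModPGaloisRep_smul_iff`, `…_quadraticTwist_iff`), and a
  newform of `W^{(−2)}` is a newform of `W₂^{(−1)}` (`LFunction_smul`) — the binders `(W₂, _, _, _, hsp₂, hirr₂, hf₂)` of `hTw`.

What is NOT here (one writer per object, pen RC-380/RC-384): the Selmer-side half (b) / the `SelmerDualData` twin
`(D₂', eD)` — seat `bsd-2adic-t42` GEN 22 (`…AdditiveSelmerTwistTransport`, Literature `QuadraticTwistSelmerInfty`,
`IwasawaSelmerCharacterTwistProofs`); the assembly of `hTw` from both halves follows in a sequel once both have landed.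
HONEST FRAMING (D-0036 / D-0054): theorems only — no definition, no named fact, no instance, no `sorry`; route-independent
(no `Theses` import); types-the-object-of (reading ↦ kernel); closes none; nothing booked; BSD is not proved by any of this.
PARTITION: X5@2 additive potentially-multiplicative block, `(−2)`-split-twist sub-blocks × `p = 2`.

References: [Rubin2000] Ch. VI §1–§2; [GreenbergLNM1716] §4 p. 107; [SilvermanAEC2009] X.2 Prop. 2.4, X.5 Cor. 5.4, VII.5
Prop. 5.1 (b), App. C §16; [Washington1997] §13.1; [Kato2004Asterisque] §12.2 (p. 220), Lemma 8.5 (2) (p. 183), §17.13.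
-/

set_option autoImplicit false
-- the summit's namespace `Summit.BirchSwinnertonDyer.BirchSwinnertonDyer` (Sub = Summit) trips `dupNamespace`
set_option linter.dupNamespace false

noncomputable section

open scoped MatrixGroups ModularForm

open Field CongruenceSubgroup WeierstrassCurve Literature.NumberTheory.EllipticCurves
  Literature.NumberTheory.EllipticCurves.ModularForms Literature.NumberTheory.EllipticCurves.PadicIntSeries
  Literature.NumberTheory.GaloisRepresentations

namespace Summit.BirchSwinnertonDyer.BirchSwinnertonDyer.Theorems.AddKatoTwoGammaTwist

open Summit.BirchSwinnertonDyer.BirchSwinnertonDyer.Theorems.PrintCf2.LayerNormCharIdeal (norm_neg_one_sub_one_lt_two)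

/-! ## §1 The `I`-half of the Galois reading: layer isomorphisms and the `Tw`-semilinear twin of every pin -/

/-- **The layer isomorphisms `ψ_n` for a model of `W^{(2)}`, in the shape of the `∃ ψ` clause of
`katoOddBranchInputsNegTwoPrintExact_of_negOne_of_layerIsos`.** For `W, W₂` elliptic over `ℚ` with `C • W₂ = W^{(2)}`,
`κ` cyclotomic and `γ` a topological generator: `ψ_n : H¹(ℚ_{n+1}, T₂W₂) ≃+ H¹(ℚ_{n+1}, T₂W)` (`n ≥ 0`), `ℤ₂`-linear,
compatible with the corestrictions, anti-commuting with `conj_γ` (Literature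
`Kato2004.exists_layerIsos_of_smul_eq_quadraticTwist_two_of_isTopGenerator`: `ψ_n = E_*` for `E : T₂W₂ ≃ T₂W` with
`E(σx) = ±σE(x)` by `σ√2 = ±√2`; `√2 ∈ ℚ₁`, `γ√2 = −√2`). [cite: Rubin2000, Ch. VI §1–§2] [cite: GreenbergLNM1716, §4 (p. 107)]
[cite: SilvermanAEC2009, X.5 Cor. 5.4] -/
theorem exists_layerIsos_two (W W₂ : WeierstrassCurve ℚ) [W.IsElliptic] [W₂.IsElliptic]
    [ContinuousSMul ℤ_[2] (W.tateModule 2)] [ContinuousSMul ℤ_[2] (W₂.tateModule 2)]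
    (C : VariableChange ℚ) (hC : C • W₂ = W.quadraticTwist 2) (κ : ZpExtension ℚ 2) (γ : absoluteGaloisGroup ℚ)
    (hκ : κ.IsCyclotomic) (hγ : κ.IsTopGenerator γ) :
    ∃ ψ : ∀ n : ℕ, H1 (Kato2004.EulerSystemValues.tateRep W₂ 2) (κ.layerSubgroup (n + 1)) ≃+
        H1 (Kato2004.EulerSystemValues.tateRep W 2) (κ.layerSubgroup (n + 1)),
      (∀ (n : ℕ) (c : ℤ_[2]) (y : H1 (Kato2004.EulerSystemValues.tateRep W₂ 2) (κ.layerSubgroup (n + 1))),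
        ψ n (c • y) = c • ψ n y) ∧
      (∀ (n : ℕ) (y : H1 (Kato2004.EulerSystemValues.tateRep W₂ 2) (κ.layerSubgroup (n + 2))),
        Kato2004.layerCores (Kato2004.EulerSystemValues.tateRep W 2) κ (n + 1) (ψ (n + 1) y) =
          ψ n (Kato2004.layerCores (Kato2004.EulerSystemValues.tateRep W₂ 2) κ (n + 1) y)) ∧
      (∀ (n : ℕ) (y : H1 (Kato2004.EulerSystemValues.tateRep W₂ 2) (κ.layerSubgroup (n + 1))),
        ψ n (conjMap (Kato2004.EulerSystemValues.tateRep W₂ 2).toTopRep (κ.layerSubgroup (n + 1)) γ 1 y) =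
          -conjMap (Kato2004.EulerSystemValues.tateRep W 2).toTopRep (κ.layerSubgroup (n + 1)) γ 1 (ψ n y)) :=
  Kato2004.exists_layerIsos_of_smul_eq_quadraticTwist_two_of_isTopGenerator κ γ C hC hκ hγ

/-- **The `Tw`-semilinear twin of every pin `𝐇¹_Γ(T₂W)` (the `I`-component of `hTw`).** For `W, W₂` elliptic over `ℚ`
with `C • W₂ = W^{(2)}`, `κ` cyclotomic and `γ` a topological generator, every `I : IwasawaH1Data W 2 κ γ` has a twin
`I₂ : IwasawaH1Data W₂ 2 κ γ` on the same group with `Λ` acting through `Tw = unitTwist · (−1)` (`(1+T) ↦ −(1+T)`):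
`eI : I₂.H ≃+ I.H`, `eI (r • h) = Tw(r) • eI h`. Composite of `exists_layerIsos_two` with the adapter
`Kato2004.iwasawaH1Data_exists_negTwist` (integrality of the twisted pin automatic along the cyclotomic tower, Kato Lemma
8.5 (2); layer `0` of `I₂` = the trace of layer `1`). [cite: Rubin2000, Ch. VI §1–§2] [cite: GreenbergLNM1716, §4 (p. 107)]
[cite: Kato2004Asterisque, §12.2 (p. 220), Lemma 8.5 (2) (p. 183)] -/
theorem exists_iwasawaH1Data_negTwist_two (W W₂ : WeierstrassCurve ℚ) [W.IsElliptic] [W₂.IsElliptic]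
    [ContinuousSMul ℤ_[2] (W.tateModule 2)] [ContinuousSMul ℤ_[2] (W₂.tateModule 2)]
    (C : VariableChange ℚ) (hC : C • W₂ = W.quadraticTwist 2) (κ : ZpExtension ℚ 2) (γ : absoluteGaloisGroup ℚ)
    (hκ : κ.IsCyclotomic) (hγ : κ.IsTopGenerator γ) (I : Kato2004.IwasawaH1Data W 2 κ γ) :
    ∃ (I₂ : Kato2004.IwasawaH1Data W₂ 2 κ γ) (eI : I₂.H ≃+ I.H),
      ∀ (r : IwasawaAlgebra 2) (h : I₂.H), eI (r • h) = unitTwist r (-1) • eI h := by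
  obtain ⟨ψ, hψ_smul, hψ_cores, hψ_conj⟩ := exists_layerIsos_two W W₂ C hC κ γ hκ hγ
  obtain ⟨I₂, eI, heI, -, -⟩ :=
    Kato2004.iwasawaH1Data_exists_negTwist norm_neg_one_sub_one_lt_two hκ ψ hψ_smul hψ_cores hψ_conj I
  exact ⟨I₂, eI, heI⟩

/-! ## §2 The `(−1)`-block avatar of a `(−2)`-block curve: a globally minimal model `W₂` of `W^{(2)}` -/

/-- **The `(−1)`-block avatar.** Every elliptic `W/ℚ` has a globally minimal `W₂` and a change of variables `C` over `ℚ`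
with `C • W₂ = W^{(2)}` (Silverman VIII.8.3: global minimal models over `ℚ`), and for any such pair:
`W₂^{(−1)} = C′ • W^{(−2)}` for an explicit `C′` (`(C⁻¹ • W^{(2)})^{(−1)} = C′ • (W^{(2)})^{(−1)}`, `(W^{(2)})^{(−1)} = W^{(−2)}`),
hence `W₂^{(−1)}` is split multiplicative at `2` iff `W^{(−2)}` is, `W₂[2]` is irreducible iff `W[2]` is (twist- and
isomorphism-invariance of `E[2]`), and every newform of `W^{(−2)}` is a newform of `W₂^{(−1)}` (`L(C′ • V, s) = L(V, s)`).
These are the binders `(W₂, hsp₂, hirr₂, hf₂)` of the hypothesis `hTw` of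
`katoOddBranchInputsNegTwoPrintExact_of_negOne_of_twTransport`. [cite: SilvermanAEC2009, VIII.8 Cor. 8.3, X.5 Cor. 5.4, VII.5 Prop. 5.1 (b), App. C §16] -/
theorem exists_negOneAvatar_of_quadraticTwist_two (W : WeierstrassCurve ℚ) [W.IsElliptic] :
    ∃ (W₂ : WeierstrassCurve ℚ) (_ : W₂.IsElliptic) (_ : W₂.IsGloballyMinimal) (C : VariableChange ℚ),
      C • W₂ = W.quadraticTwist 2 ∧
      ((W₂.quadraticTwist (-1)).HasSplitMultiplicativeReductionAtPrime 2 ↔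
        (W.quadraticTwist (-2)).HasSplitMultiplicativeReductionAtPrime 2) ∧
      (W₂.HasIrreducibleModPGaloisRep 2 ↔ W.HasIrreducibleModPGaloisRep 2) ∧
      ∀ {N : ℕ} [NeZero N] (f : CuspForm (Gamma0 N) 2),
        IsNewformOf (W.quadraticTwist (-2)) f → IsNewformOf (W₂.quadraticTwist (-1)) f := by
  -- a globally minimal model `W₂` of `W^{(2)}`
  haveI hE2 : (W.quadraticTwist 2).IsElliptic := W.isElliptic_quadraticTwist two_ne_zero
  obtain ⟨C₀, hC₀⟩ := hasGlobalMinimalModel_rat_holds (W.quadraticTwist 2)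
  set W₂ : WeierstrassCurve ℚ := C₀ • W.quadraticTwist 2 with hW₂_def
  have hC : C₀⁻¹ • W₂ = W.quadraticTwist 2 := by rw [hW₂_def, inv_smul_smul]
  -- `W₂^{(−1)} = C′ • W^{(−2)}` with `C′ = (u, −r, 0, 0)` for `C₀ = (u, r, s, t)`
  have htw : W₂.quadraticTwist (-1) = (⟨C₀.u, -C₀.r, 0, 0⟩ : VariableChange ℚ) • W.quadraticTwist (-2) := by
    rw [hW₂_def, quadraticTwist_smul, quadraticTwist_quadraticTwist]
    norm_num
  haveI hEm2 : (W.quadraticTwist (-2)).IsElliptic := W.isElliptic_quadraticTwist (by norm_num)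
  refine ⟨W₂, inferInstance, hC₀, C₀⁻¹, hC, ?_, ?_, ?_⟩
  · -- split multiplicative reduction at `2` is a `ℚ`-isomorphism invariant
    rw [htw]
    exact hasSplitMultiplicativeReductionAtPrime_smul_iff (W.quadraticTwist (-2)) _ 2
  · -- `W₂[2] ≅ W^{(2)}[2]`, irreducible iff `W[2]` is
    rw [hW₂_def, Mazur1978.hasIrreducibleModPGaloisRep_smul_iff, hasIrreducibleModPGaloisRep_quadraticTwist_iff W two_ne_zero]
  · -- `L(W₂^{(−1)}, s) = L(W^{(−2)}, s)`
    intro N _ f hf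
    refine ⟨hf.1, fun n ↦ ?_⟩
    rw [hf.2 n, htw, LFunction_smul]

end Summit.BirchSwinnertonDyer.BirchSwinnertonDyer.Theorems.AddKatoTwoGammaTwist

end
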